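import Literature.NumberTheory.GaloisRepresentations.PstWeilDeligne
import HarnessLib

/-!
# `ReciprocityUpToIrreducibility` (stmt-Langlands-14328) — negative knowledge (tightness):
# rank-zero representations are de Rham for every `p`-adic Hodge datum

Sorry-free (cdisprove cycle 1, seat refuter-cdisprove-stmt-Langlands-14328-0).  Line `Sketch` of the
crux (lead prover-line-stmt-Langlands-14328-0) carries `stub_deRhamBlocks` — de Rham heredity for
block-triangular framed representations along `e : Fin m ⊕ Fin p ≃ Fin n`, for EVERY datum
`𝔇 : PstWeilDeligneData F ℓ`.  Its degenerate edges `m = 0` / `p = 0` (a block of size zero) are the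
cheapest place where a junk instance could bite; this file records that they do not:
`isDeRhamFramed_of_rank_zero` — every `ρ : Γ_F →ₜ* GL₀(ℚ̄_ℓ)` is `𝔇`-de Rham for every datum (model
over `ℚ_ℓ` itself, `HasQlModel` by `GL₀` being a singleton, and both sides of Fontaine's admissibility
condition `finrank_F (B ⊗ V)^Γ = finrank_{ℚ_ℓ} V` vanish).  The substantive cases of the stub are
Fontaine, Exp. III Prop. 1.5.2 for the regular ring `𝔇.𝔅` (not attacked: true). [folklore]
-/

noncomputable section

set_option linter.dupNamespace false -- project-wide option; `Summit.Langlands.Langlands` is the mandated namespace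

open Field TensorProduct
open Literature.NumberTheory.Automorphic Literature.NumberTheory.GaloisRepresentations

namespace Summit.Langlands.Langlands.Theorems.ReciprocityUpToIrreducibility.Negative

variable {F : Type} [Field F] [ValuativeRel F] [TopologicalSpace F] [IsNonarchimedeanLocalField F]
  {ℓ : ℕ} [Fact ℓ.Prime]

/-- **Rank-zero representations are de Rham for EVERY `p`-adic Hodge datum** (model over `ℚ_ℓ`
itself; both dimensions in Fontaine's admissibility condition vanish).  So the edges `m = 0` / `p = 0`
of `stub_deRhamBlocks` (a block of size zero) carry no junk. [folklore] -/
theorem isDeRhamFramed_of_rank_zero (𝔇 : PstWeilDeligneData F ℓ)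
    (ρ : FramedRep (absoluteGaloisGroup F) (PadicAlgCl ℓ) 0) : 𝔇.IsDeRhamFramed ρ := by
  letI := 𝔇.algebra
  refine ⟨⊥, inferInstance, 1, ⟨1, DFunLike.ext _ _ fun σ => Subsingleton.elim _ _⟩, ?_⟩
  show Module.finrank F _ = Module.finrank ℚ_[ℓ] (Fin 0 → (⊥ : IntermediateField ℚ_[ℓ] (PadicAlgCl ℓ)))
  have h0 : Module.finrank ℚ_[ℓ] (Fin 0 → (⊥ : IntermediateField ℚ_[ℓ] (PadicAlgCl ℓ))) = 0 :=
    Module.finrank_zero_of_subsingleton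
  haveI : Subsingleton (𝔇.𝔅.B ⊗[ℚ_[ℓ]] (Fin 0 → (⊥ : IntermediateField ℚ_[ℓ] (PadicAlgCl ℓ)))) := by
    refine ⟨fun x y => ?_⟩
    have hx : ∀ z : 𝔇.𝔅.B ⊗[ℚ_[ℓ]] (Fin 0 → (⊥ : IntermediateField ℚ_[ℓ] (PadicAlgCl ℓ))), z = 0 :=
      fun z => z.induction_on rfl (fun b m => by rw [Subsingleton.elim m 0, tmul_zero])
        (fun x y hx hy => by rw [hx, hy, add_zero])
    rw [hx x, hx y]
  rw [h0]
  exact Module.finrank_zero_of_subsingleton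

/-- The `m = 0` edge of `stub_deRhamBlocks` (sub-block of size zero): its first conjunct holds outright,
whatever `T`, `D` and the hypotheses. [folklore] -/
theorem stub_deRhamBlocks_edge_rank_zero (𝔇 : PstWeilDeligneData F ℓ) {p n : ℕ}
    (_T : FramedRep (absoluteGaloisGroup F) (PadicAlgCl ℓ) n)
    (A : FramedRep (absoluteGaloisGroup F) (PadicAlgCl ℓ) 0)
    (_D : FramedRep (absoluteGaloisGroup F) (PadicAlgCl ℓ) p) :
    𝔇.IsDeRhamFramed A :=
  isDeRhamFramed_of_rank_zero 𝔇 A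

end Summit.Langlands.Langlands.Theorems.ReciprocityUpToIrreducibility.Negative

end
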